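import Summits.MatrixMultiplication.OmegaCensus.STPPVosperCoverExtractW
import Summits.MatrixMultiplication.OmegaCensus.STPPVosperSlackOneCoverSteps

/-!
# ω-census (abelian STPP census): steps for the slack-1 cover law WITH WORDS — both search orders, the α₂ cover test, the admissible-offset checker (kernel)

HONEST FRAMING (pub-omega census; verbatim): lottery ticket; floor = certified bounds/negative ranges.
Census STRUCTURE (seat pub-omega-stpp-2 gen 25, 2026-08-28), family (b2).  Word-layer twins of `STPPVosperSlackOneCoverSteps.lean` for the law
`no_isSTPP_of_slack_one_coverW_prime_a2` (`STPPVosperSlackOneCoverLawA2W.lean`): `coverA2W` (the α₂ cover test through `coverSearchW`),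
`cover_bothW_of_isSTPP` (Y-first and Z-first `coverSearchW` are both sound), and the cheap ADMISSIBLE-OFFSET checker `alpha2AdmOK` (for one `(j, ℓ₁)`: every
offset `δ = t₂ − t₁` of a window/prefix-admissible pair lies in a given list `D`) with its meaning — so that kill files can certify the α₂ hypothesis of the law
(stated in spec form) offset by offset, one kernel search per theorem.  Nothing here is progress on `ω`.

References: H. Cohn, R. Kleinberg, B. Szegedy, C. Umans, FOCS 2005 (arXiv:math/0511460), Def. 5.1.
-/

open Finset
open scoped Pointwise

namespace Summit.MatrixMultiplication.OmegaCensus.CubeNB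

open Literature.Computability.AlgebraicComplexity
open Literature.Combinatorics.Additive
open Summit.MatrixMultiplication.OmegaCensus.STPPKneser

/-! ## §1 The α₂ cover test with words and the admissible-offset checker -/

section Checkers

/-- The cover test WITH WORDS of an α₂ row-shape `(j, ℓ₁, δ)`, Z-first (`zfirst = true`) or Y-first. [folklore] -/
def coverA2W (p L z : ℕ) (sAB sBA : List (ℕ × ℕ × ℕ)) (zfirst : Bool) (j ℓ₁ δ : ℕ) : Bool :=
  if zfirst then coverSearchW p (List.range z) (twoRunVals p j ℓ₁ δ L) sBA else coverSearchW p (twoRunVals p j ℓ₁ δ L) (List.range z) sAB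

/-- **Admissible offsets of one `(j, ℓ₁)`** (`Bool`): `j ∈ J`, or every pair `(t₁, t₂)` of run starts passing the two window tests and the prefix test has its
offset `(t₂ − t₁) mod p` in the list `D`. [folklore] -/
def alpha2AdmOK (p n₁ L r : ℕ) (J : Finset ℕ) (j ℓ₁ : ℕ) (D : List ℕ) : Bool :=
  decide (j ∈ J) ||
    ((List.range p).filter fun t₁ => (List.range (ℓ₁ + 1)).all fun i => decide ((t₁ + j * i) % p < n₁)).all fun t₁ =>
      ((List.range p).filter fun t₂ => (List.range (L - ℓ₁ + 1)).all fun i => decide ((t₂ + j * i) % p < n₁)).all fun t₂ =>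
        !(prefixOK r ((range (ℓ₁ + 1)).image (fun i => (t₁ + j * i) % p) ∪ (range (L - ℓ₁ + 1)).image (fun i => (t₂ + j * i) % p))) ||
          decide ((t₂ + p - t₁) % p ∈ D)

/-- **Meaning of the admissible-offset checker.** [folklore] -/
theorem alpha2AdmOK_spec {p n₁ L r : ℕ} {J : Finset ℕ} {j ℓ₁ : ℕ} {D : List ℕ} (h : alpha2AdmOK p n₁ L r J j ℓ₁ D = true) :
    ∀ t₁ < p, ∀ t₂ < p, (∀ i < ℓ₁ + 1, (t₁ + j * i) % p < n₁) → (∀ i < L - ℓ₁ + 1, (t₂ + j * i) % p < n₁) →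
      prefixOK r ((range (ℓ₁ + 1)).image (fun i => (t₁ + j * i) % p) ∪ (range (L - ℓ₁ + 1)).image (fun i => (t₂ + j * i) % p)) = true →
      j ∈ J ∨ (t₂ + p - t₁) % p ∈ D := by
  intro t₁ ht₁ t₂ ht₂ hw1 hw2 hpre
  rw [alpha2AdmOK, Bool.or_eq_true, decide_eq_true_eq] at h
  rcases h with hJ | h
  · exact Or.inl hJ
  right
  rw [List.all_eq_true] at h
  have hT₁ : t₁ ∈ (List.range p).filter fun t₁ => (List.range (ℓ₁ + 1)).all fun i => decide ((t₁ + j * i) % p < n₁) := by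
    rw [List.mem_filter, List.mem_range, List.all_eq_true]
    exact ⟨ht₁, fun i hi => decide_eq_true (hw1 i (List.mem_range.1 hi))⟩
  have h2 := h t₁ hT₁
  rw [List.all_eq_true] at h2
  have hT₂ : t₂ ∈ (List.range p).filter fun t₂ => (List.range (L - ℓ₁ + 1)).all fun i => decide ((t₂ + j * i) % p < n₁) := by
    rw [List.mem_filter, List.mem_range, List.all_eq_true]
    exact ⟨ht₂, fun i hi => decide_eq_true (hw2 i (List.mem_range.1 hi))⟩
  have h3 := h2 t₂ hT₂
  rw [Bool.or_eq_true, Bool.not_eq_true', decide_eq_true_eq, hpre] at h3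
  rcases h3 with h3 | h3
  · exact absurd h3 (by decide)
  · exact h3

end Checkers

/-! ## §2 Both search orders with words are sound -/

section Both

variable {p : ℕ} [hp : Fact p.Prime]

/-- **Both search orders with words are sound** (as `cover_both_of_isSTPP`, through `coverSearchW_of_isSTPP`). [cite: CohnKleinbergSzegedyUmans2005, Def. 5.1] -/
theorem cover_bothW_of_isSTPP {N : ℕ} {A B C : Fin N → Finset (ZMod p)} (hS : IsSTPP A B C) (hA : ∀ k, (A k).Nonempty) (hB : ∀ k, (B k).Nonempty)
    (hC : ∀ k, (C k).Nonempty) (i : Fin N) (ks : List (Fin N)) (hks : ks.Nodup) (hksi : ∀ k, k ∈ ks ↔ k ≠ i) {u y₀ z₀ : ZMod p} (hu0 : u ≠ 0)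
    {YL ZL : List ℕ}
    (hY1 : ∀ x ∈ DU B C (univ.erase i), (u * (x - y₀)).val ∈ YL) (hY2 : ∀ t ∈ YL, ∃ x ∈ DU B C (univ.erase i), (u * (x - y₀)).val = t)
    (hZ1 : ∀ x ∈ DU A C (univ.erase i), (u * (x - z₀)).val ∈ ZL) (hZ2 : ∀ t ∈ ZL, ∃ x ∈ DU A C (univ.erase i), (u * (x - z₀)).val = t) :
    coverSearchW p YL ZL (ks.map fun k => (#(A k), #(B k), #(C k))) = true ∧
      coverSearchW p ZL YL (ks.map fun k => (#(B k), #(A k), #(C k))) = true :=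
  ⟨coverSearchW_of_isSTPP hS hA hB hC i ks hks hksi hu0 hY1 hY2 hZ1 hZ2,
    coverSearchW_of_isSTPP (STPP222SqNeg.isSTPP_swapBC (stpp_rotate hS)) hB hA hC i ks hks hksi hu0 hZ1 hZ2 hY1 hY2⟩

end Both

end Summit.MatrixMultiplication.OmegaCensus.CubeNB
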